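import Literature.MathematicalPhysics.QuantumFieldTheory.Balaban1983to89.B3Sect3VectorSelfEnergy
import Literature.MathematicalPhysics.QuantumFieldTheory.Balaban1983to89.B3Sect3TriangleGraphs
import Literature.Analysis.FunctionSpaces.LatticeGreenKernel
import Literature.Analysis.FunctionSpaces.TorusFourierModes
import Literature.Analysis.FunctionSpaces.LatticeParseval
import HarnessLib

/-!
# B3 — T. Bałaban, *(Higgs)₂,₃ quantum fields in a finite volume. III. Renormalization*, CMP **88** (1983) 411–445
[Balaban1983Higgs3]: the FIRST equalities of (3.24) p. 439 and (3.28) p. 441 — the lattice sums over ξℤ^d as momentum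
integrals (Plancherel on ξℤ^d) — PROVED; hence the named facts `Eq324`, `Eq328` of `B3Sect3VectorSelfEnergy` hold (ξ > 0)

statement-level skeleton of published theorems with citation tags; proofs where landed; nothing here is a claim about
the Yang–Mills mass gap

Rows **B3.Eq3.21-3.24** ((3.24)) and **B3.Eq3.25-3.32** ((3.28)) of `HOME/lit-balaban-r15/ROWS-B3.md` (reader/typer and fold
owner r15).  Phase-2 proof seat p03 (gen 2).  The two displays were typed by r15 as the named facts
`B3Sect3VectorSelfEnergy.Eq324 d ξ` / `Eq328 d ξ` (each the conjunction of the two printed equalities); r15 proved the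
SECOND equalities (the ξ-rescaling p = p′/ξ, `eq324_rescale`, and the reflection/permutation symmetry of the box,
`eq328_second`) and left the FIRST ones — *the lattice sum equals the momentum integral* — typed only (file docstring:
"the FIRST equality (the lattice sum as the momentum integral, Plancherel on ξℤ^d) remains typed only").  This file proves
them, so that `eq324_holds : 0 < ξ → Eq324 d ξ` and `eq328_holds : 0 < ξ → Eq328 d ξ` discharge both facts outright.

THE PRINTED TEXT (verbatim, p. 439 [PDF 29]): *"We have further
Σ_{x′} ξ^d(∂^ξ_μC^ξ)(x−x′)C^ξ(x−x′) = (2π)^{−d} ∫_{|p|≤π/ξ} dp ∂^ξ_μ(p)/(Δ^ξ(p)+1)² = (2π)^{−d} ∫_{|p′|≤π} dp′ (cos p′_μ − 1)/(Δ¹(p′)+ξ²)²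
ξ^{3−d}, (3.24) and the expression on the right side has a finite limit as ξ → 0."*; p. 441 [PDF 31]: *"Σ_{y′} ξ^d(C^ξ(y′+ξe_μ)
− C^ξ(y′−ξe_μ))(∂^ξ_{μ′}C^ξ)(y′) = 2(2π)^{−d}∫_{|p|≤π/ξ} dp ξ^{−1} sin ξp_μ sin ξp_{μ′}/(Δ^ξ(p)+1)² = … (3.28)"*, with
C^ξ = (−Δ^ξ + 1)^{−1} (p. 437) given, as typed by r15 (`Cxi`), by its momentum integral C^ξ(y) = (2π)^{−d}∫_{|p|≤π/ξ}
cos(ξp·y)/(Δ^ξ(p)+1) dp, Δ^ξ(p) = Σ_μ ξ^{−2}(2 − 2cos ξp_μ) (`lapSymbol`), ∂^ξ_μ(p) read as ξ^{−1}(cos ξp_μ − 1) (r15 T4).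

THE PROOF (standard Fourier analysis on the dual torus; the paper gives none).  Substituting p = (2π/ξ)θ identifies the
Brillouin box |p_μ| ≤ π/ξ with the cube θ ∈ (−½,½]^d = a fundamental domain of T^d = (ℝ/ℤ)^d
(`box_integral_eq_cube`: (2π)^{−d}∫_{|p|≤π/ξ} G = ξ^{−d}∫_{(−½,½]^d} G((2π/ξ)θ) dθ, Lebesgue scaling on ℝ^d + the null
boundary; `integral_torus_eq_cube`: Mathlib's `UnitAddTorus.integral_preimage` transported to the global volume), under
which Δ^ξ((2π/ξ)θ) = ξ^{−2}μ(θ) with μ = `LatticeFourier.latticeDispersion` = Σ_i 4 sin²(πθ_i) (`lapSymbol_smul`).  Hence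
**ξ^d C^ξ(y) = 𝓕_{T^d}[σ_ξ](y)**, the y-th Fourier coefficient of the continuous even symbol σ_ξ(θ) = (ξ^{−2}μ(θ)+1)^{−1}
(`mFourierCoeff_symb`; the coefficients are real by evenness, `LatticeFourier.im_mFourierCoeff_eq_zero_of_even`).
Translation of y by ∓e_μ is multiplication of σ_ξ by the character e_{±e_μ} (`mFourierCoeff_mFourier_mul`), so
ξ^d(∂^ξ_μC^ξ)(y) = 𝓕[Φ_μ](y) with Φ_μ = ξ^{−1}(e_{−e_μ} − 1)σ_ξ (`mFourierCoeff_pdiff_symb`) and ξ^d(C^ξ(y+e_μ) − C^ξ(y−e_μ)) =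
𝓕[Ψ_μ](y) with Ψ_μ = (e_{−e_μ} − e_{e_μ})σ_ξ (`mFourierCoeff_cdiff_symb`).  The polarised Plancherel identity on T^d for
`L²` functions (tree: `Torus.hasSum_conj_mul_mFourierCoeff`, from Mathlib's `UnitAddTorus.hasSum_prod_mFourierCoeff`) then
gives Σ_y 𝓕Φ(y)𝓕F(y) = ∫_{T^d} Re(conj Φ · F) for real coefficient sequences (`hasSum_mul_of_coeff`; the sums converge
absolutely, so the printed Σ — typed as a `tsum` after the reindexing x′ ↦ x − x′ — is this `HasSum`), and the pointwise
identities Re[(e_{e_μ} − 1)σ²] = (cos 2πθ_μ − 1)σ², Re[(e_{e_μ} − e_{−e_μ})·ξ^{−1}(e_{−e_{μ′}} − 1)σ²] = 2ξ^{−1} sin 2πθ_μ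
sin 2πθ_{μ′} σ² (`re_conj_pdiff_symb_mul`, `re_conj_cdiff_symb_mul`) turn the right sides back into the printed box
integrals.  No parity argument is needed for the imaginary parts: the left sides are real.

DEPENDENCES.  `B3Sect3VectorSelfEnergy` (r15: `Cxi`, `lapSymbol`, `bzBox`, `pdiffZ`, `unitVec`, `sum328`, `Eq324`, `Eq328`,
`eq324_rescale`, `eq328_second`), `Literature.Analysis.FunctionSpaces.{LatticeDispersion, LatticeGreenKernel,
TorusVectorParseval, TorusFourierCalculus, TorusTrigPoly, TorusSobolevNorm, TorusFourierModes, FlatTorus}` (lattice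
dispersion, evenness/realness of coefficients, Plancherel and Fourier-coefficient calculus for the global volume),
Mathlib `Analysis.Fourier.AddCircleMulti`.  Theorems only; no definition, no new named fact; net debt −2.

v1.1 (append-only, p03 gen 2; row **B3.Eq3.33-3.38**): §6 proves the named fact `B3Sect3TriangleGraphs.Eq338 d ξ q3` of r15's
`B3Sect3TriangleGraphs` — the printed chain **(3.38)** p. 444 FOR C^ξ ITSELF, first member = last member (= 0) — for ξ > 0
(`eq338_holds`), in momentum space: the convolution theorem on T^d (`hasSum_coeff_conv`, the polarised Plancherel identity
applied to e_w·conj G and H) evaluates the iterated lattice sum (`hasSum_triple`; the characters e_{±y′} cancel — translation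
invariance), the difference quotients ∂^ξ, ∂^{ξ*} act as the multipliers ξ^{−1}(e_{∓e_μ} − 1) (`coeff_pdiffZ`, `coeff_pdiffAdjZ`),
and the resulting integrand ξ^{−3}|e_{e_ν} − 1|²σ_ξ³(ē_{e_μ} − e_{e_μ}) has zero real part while the sum is real.  The paper's own
route (summation by parts and (−Δ^ξ + 1)C^ξ = δ^ξ of (3.16)) is r15 g4's position-space lane (`B3CxiPropagator`); this file uses
neither.  One import added (`B3Sect3TriangleGraphs`, downstream of `B3Sect3VectorSelfEnergy`); §§1–5 unchanged.

v1.2 (append-only, p03 gen 2; row **B3.Eq3.21-3.24**): §7 proves the SENTENCE after (3.24), p. 439: *"and the expression on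
the right side has a finite limit as ξ → 0"*, for the right member of (3.24) exactly as typed in `Eq324` and the paper's
dimensions: `eq324_rhs_tendsto_three` (d = 3: limit (2π)^{−3}∫_{|p′|≤π}(cos p′_μ − 1)/Δ¹(p′)², by dominated convergence with
the bound 1/(2Δ¹) — integrable on the box because 1/μ ∈ L¹(T³), `LatticeFourier.integrable_inv_latticeDispersion`, transported
box ↔ cube ↔ torus in ℝ≥0∞ by `integrableOn_bzBox_of_torus`), `eq324_rhs_tendsto_two` (d = 2: limit 0, rate |ξ|^{1/2}, from the
weighted AM–GM bound 1/(Δ+ξ²) ≤ Δ^{−3/4}(ξ²)^{−1/4} and μ^{−3/4} ∈ L¹(T²), `integrable_rpow_latticeDispersion_two`), packaged as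
`eq324_rhs_finite_limit (hd : d = 2 ∨ d = 3)`.  One import added (`Literature.Analysis.FunctionSpaces.LatticeParseval`, for the
ℝ≥0∞ transport lemmas `Torus.lintegral_eq_lintegral_cube`, `lintegral_comp_smul`); §§1–6 unchanged.
-/

open MeasureTheory Set Filter UnitAddTorus
open scoped BigOperators ComplexConjugate

namespace Literature.MathematicalPhysics.QuantumFieldTheory.Balaban1983to89.B3Eq324Parseval

open B3Sect3VectorSelfEnergy
open Literature.Analysis.FunctionSpaces Literature.Analysis.FunctionSpaces.LatticeFourier
open Literature.Analysis.FunctionSpaces.Torus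

noncomputable section

variable {d : ℕ} {ξ : ℝ}

/-! ## 1. Torus bookkeeping: Fourier coefficients of continuous functions, shifts, Plancherel -/

section Torus

/-- Continuous functions on the compact torus are in `L²` (global volume). [folklore] -/
private theorem memLp_two_of_continuous {f : UnitAddTorus (Fin d) → ℂ} (hf : Continuous f) :
    MemLp f 2 volume :=
  let g : C(UnitAddTorus (Fin d), ℂ) := ⟨f, hf⟩
  MemLp.of_bound hf.aestronglyMeasurable ‖g‖ (ae_of_all _ fun x => g.norm_coe_le_norm x)

/-- Multiplication by a character shifts the Fourier coefficients: `𝓕(e_m · G)(k) = 𝓕G(k − m)`. [folklore] -/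
private theorem mFourierCoeff_mFourier_mul (G : UnitAddTorus (Fin d) → ℂ) (m k : Fin d → ℤ) :
    mFourierCoeff (fun θ => mFourier m θ * G θ) k = mFourierCoeff G (k - m) := by
  unfold mFourierCoeff
  refine integral_congr_ae (ae_of_all _ fun θ => ?_)
  simp only [smul_eq_mul, ← mul_assoc, ← mFourier_add]
  rw [show -k + m = -(k - m) by abel]

/-- **Plancherel, polarised, for continuous functions with real Fourier coefficients**: if `𝓕Φ = u`, `𝓕F = v` are
real sequences then `Σ_y u(y)v(y) = ∫ Re(conj Φ · F)` as a `HasSum` (from the tree's `Torus.hasSum_conj_mul_mFourierCoeff`).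
[folklore] -/
private theorem hasSum_mul_of_coeff {Φ F : UnitAddTorus (Fin d) → ℂ} (hΦ : Continuous Φ) (hF : Continuous F)
    {u v : (Fin d → ℤ) → ℝ} (hu : ∀ y, mFourierCoeff Φ y = (u y : ℂ)) (hv : ∀ y, mFourierCoeff F y = (v y : ℂ)) :
    HasSum (fun y => u y * v y) (∫ θ, (conj (Φ θ) * F θ).re) := by
  have h := hasSum_conj_mul_mFourierCoeff (memLp_two_of_continuous hΦ) (memLp_two_of_continuous hF)
  simp only [hu, hv, Complex.conj_ofReal, ← Complex.ofReal_mul] at h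
  have h2 := Complex.reCLM.hasSum h
  simp only [Complex.reCLM_apply, Complex.ofReal_re] at h2
  have hint : Integrable (fun θ => conj (Φ θ) * F θ) volume :=
    (hΦ.star.mul hF).integrable_unitAddTorus
  have h3 : (∫ θ, conj (Φ θ) * F θ).re = ∫ θ, (conj (Φ θ) * F θ).re := by
    have := integral_re hint
    simpa using this.symm
  rwa [h3] at h2

/-- Integration over the torus (global volume) = integration of the lift over the cube (−½,½]^d. [folklore] -/
private theorem integral_torus_eq_cube (f : UnitAddTorus (Fin d) → ℝ) :
    ∫ θ, f θ = ∫ x in {x : Fin d → ℝ | ∀ i, x i ∈ Ioc (-(1 / 2 : ℝ)) (-(1 / 2) + 1)}, f (fun i => (x i : UnitAddCircle)) :=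
  (congrArg (fun ν : Measure (UnitAddTorus (Fin d)) => ∫ θ, f θ ∂ν) (volume_eq_pi_haarAddCircle (d := Fin d))).trans
    (UnitAddTorus.integral_preimage f fun _ => -(1 / 2 : ℝ))

/-- A character on a representative: `e_n(x mod 1) = exp(2πi n·x)`. [folklore] -/
private theorem mFourier_coe (n : Fin d → ℤ) (x : Fin d → ℝ) :
    mFourier n (fun i => ((x i : ℝ) : UnitAddCircle)) =
      Complex.exp (((2 * Real.pi * ∑ i, (n i : ℝ) * x i : ℝ) : ℂ) * Complex.I) := by
  simp only [mFourier, ContinuousMap.coe_mk, fourier_coe_apply]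
  rw [← Complex.exp_sum]
  congr 1
  push_cast
  rw [Finset.mul_sum, Finset.sum_mul]
  exact Finset.sum_congr rfl fun i _ => by ring

/-- Real part of a character on a representative. [folklore] -/
private theorem re_mFourier_coe (n : Fin d → ℤ) (x : Fin d → ℝ) :
    (mFourier n (fun i => ((x i : ℝ) : UnitAddCircle))).re = Real.cos (2 * Real.pi * ∑ i, (n i : ℝ) * x i) := by
  rw [mFourier_coe, Complex.exp_ofReal_mul_I_re]

/-- The single-coordinate character on a representative: real and imaginary parts. [folklore] -/
private theorem re_mFourier_single_coe (μ : Fin d) (x : Fin d → ℝ) :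
    (mFourier (Pi.single μ 1) (fun i => ((x i : ℝ) : UnitAddCircle))).re = Real.cos (2 * Real.pi * x μ) ∧
      (mFourier (Pi.single μ 1) (fun i => ((x i : ℝ) : UnitAddCircle))).im = Real.sin (2 * Real.pi * x μ) := by
  rw [mFourier_single, fourier_one_coe, mul_comm Complex.I, Complex.exp_ofReal_mul_I_re, Complex.exp_ofReal_mul_I_im]
  exact ⟨rfl, rfl⟩

end Torus

/-! ## 2. The Brillouin box |p_μ| ≤ π/ξ versus the cube (−½,½]^d: p = (2π/ξ)x -/

section Box

/-- kernel: the cubes as `Set.pi`. [folklore] -/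
private theorem iocCube_eq_pi (d : ℕ) :
    {x : Fin d → ℝ | ∀ i, x i ∈ Ioc (-(1 / 2 : ℝ)) (-(1 / 2) + 1)} =
      Set.univ.pi fun _ => Ioc (-(1 / 2 : ℝ)) (-(1 / 2) + 1) := by
  ext x; simp only [mem_setOf_eq, mem_univ_pi]

/-- kernel: the closed cube as `Set.pi`. [folklore] -/
private theorem iccCube_eq_pi (d : ℕ) :
    {x : Fin d → ℝ | ∀ i, x i ∈ Icc (-(1 / 2 : ℝ)) (-(1 / 2) + 1)} =
      Set.univ.pi fun _ => Icc (-(1 / 2 : ℝ)) (-(1 / 2) + 1) := by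
  ext x; simp only [mem_setOf_eq, mem_univ_pi]

/-- kernel: for ξ > 0 the dilation x ↦ (2π/ξ)x pulls the box |p_μ| ≤ π/ξ back to the closed cube |x_μ| ≤ ½. [folklore] -/
private theorem preimage_smul_bzBox (hξ : 0 < ξ) :
    (fun x : Fin d → ℝ => (2 * Real.pi / ξ) • x) ⁻¹' bzBox d ξ =
      {x : Fin d → ℝ | ∀ i, x i ∈ Icc (-(1 / 2 : ℝ)) (-(1 / 2) + 1)} := by
  have hR : 0 < 2 * Real.pi / ξ := div_pos Real.two_pi_pos hξ
  ext x
  simp only [bzBox, mem_preimage, mem_setOf_eq, Pi.smul_apply, smul_eq_mul, abs_mul, abs_of_pos hR, mem_Icc]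
  refine forall_congr' fun μ => ?_
  have hπξ : 0 < Real.pi / ξ := div_pos Real.pi_pos hξ
  rw [show 2 * Real.pi / ξ * |x μ| = Real.pi / ξ * (2 * |x μ|) by ring, mul_le_iff_le_one_right hπξ,
    show -(1 / 2 : ℝ) + 1 = 1 / 2 by norm_num, ← abs_le]
  constructor <;> intro h <;> linarith

/-- **Box ↔ cube** (the substitution p = (2π/ξ)x): (2π)^{−d}∫_{|p_μ|≤π/ξ} G(p) dp = ξ^{−d}∫_{(−½,½]^d} G((2π/ξ)x) dx for ξ > 0.
[cite: Balaban1983Higgs3, (3.24) p.439] -/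
private theorem box_integral_eq_cube (hξ : 0 < ξ) (G : (Fin d → ℝ) → ℝ) :
    (2 * Real.pi)⁻¹ ^ d * ∫ p in bzBox d ξ, G p =
      (ξ ^ d)⁻¹ * ∫ x in {x : Fin d → ℝ | ∀ i, x i ∈ Ioc (-(1 / 2 : ℝ)) (-(1 / 2) + 1)}, G ((2 * Real.pi / ξ) • x) := by
  have hR : 0 < 2 * Real.pi / ξ := div_pos Real.two_pi_pos hξ
  have hmeas : MeasurableSet (bzBox d ξ) := by
    have h : bzBox d ξ = ⋂ μ : Fin d, {p : Fin d → ℝ | |p μ| ≤ Real.pi / ξ} := by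
      ext p; simp only [bzBox, mem_setOf_eq, mem_iInter]
    rw [h]
    exact MeasurableSet.iInter fun μ => (isClosed_le (continuous_apply μ).abs continuous_const).measurableSet
  have hmeasIcc : MeasurableSet {x : Fin d → ℝ | ∀ i, x i ∈ Icc (-(1 / 2 : ℝ)) (-(1 / 2) + 1)} := by
    rw [iccCube_eq_pi]; exact MeasurableSet.univ_pi fun _ => measurableSet_Icc
  have hind : (fun x : Fin d → ℝ => (bzBox d ξ).indicator G ((2 * Real.pi / ξ) • x)) =
      {x : Fin d → ℝ | ∀ i, x i ∈ Icc (-(1 / 2 : ℝ)) (-(1 / 2) + 1)}.indicator (fun x => G ((2 * Real.pi / ξ) • x)) := by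
    funext x
    rw [← preimage_smul_bzBox hξ]
    rfl
  -- change of variables on ℝ^d
  have hcv := Measure.integral_comp_smul volume ((bzBox d ξ).indicator G) (2 * Real.pi / ξ)
  rw [Module.finrank_fin_fun, smul_eq_mul, abs_of_pos (inv_pos.2 (pow_pos hR d)), hind, integral_indicator hmeasIcc,
    integral_indicator hmeas] at hcv
  have hae : {x : Fin d → ℝ | ∀ i, x i ∈ Ioc (-(1 / 2 : ℝ)) (-(1 / 2) + 1)} =ᵐ[volume]
      {x : Fin d → ℝ | ∀ i, x i ∈ Icc (-(1 / 2 : ℝ)) (-(1 / 2) + 1)} := by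
    rw [iocCube_eq_pi, iccCube_eq_pi, MeasureTheory.volume_pi]
    exact Measure.pi_Ioc_ae_eq_pi_Icc
  rw [setIntegral_congr_set hae, hcv, ← mul_assoc]
  congr 1
  rw [← mul_inv, ← mul_pow, inv_pow]
  congr 2
  field_simp

end Box

/-! ## 3. The symbol σ_ξ(θ) = (ξ^{−2}μ(θ) + 1)^{−1} on T^d and C^ξ as its Fourier coefficients -/

section Symbol

/-- kernel: `ξ^{−2}μ(θ) + 1 > 0`. [folklore] -/
private theorem symb_den_pos (ξ : ℝ) (θ : UnitAddTorus (Fin d)) : 0 < ξ⁻¹ ^ 2 * latticeDispersion θ + 1 :=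
  add_pos_of_nonneg_of_pos (mul_nonneg (sq_nonneg _) (latticeDispersion_nonneg θ)) one_pos

/-- kernel: the symbol is continuous. [folklore] -/
private theorem continuous_symb (ξ : ℝ) :
    Continuous fun θ : UnitAddTorus (Fin d) => (ξ⁻¹ ^ 2 * latticeDispersion θ + 1)⁻¹ :=
  ((continuous_const.mul continuous_latticeDispersion).add continuous_const).inv₀ fun θ => (symb_den_pos ξ θ).ne'

/-- kernel: the symbol as a complex-valued function is continuous. [folklore] -/
private theorem continuous_symbC (ξ : ℝ) :
    Continuous fun θ : UnitAddTorus (Fin d) => (((ξ⁻¹ ^ 2 * latticeDispersion θ + 1)⁻¹ : ℝ) : ℂ) :=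
  Complex.continuous_ofReal.comp (continuous_symb ξ)

/-- kernel: the symbol on a representative, `σ_ξ(x mod 1) = (ξ^{−2}Σ_i 4 sin²(πx_i) + 1)^{−1}`. [folklore] -/
private theorem symb_coe (ξ : ℝ) (x : Fin d → ℝ) :
    (ξ⁻¹ ^ 2 * latticeDispersion (fun i => ((x i : ℝ) : UnitAddCircle)) + 1)⁻¹ =
      (ξ⁻¹ ^ 2 * (∑ i, 4 * Real.sin (Real.pi * x i) ^ 2) + 1)⁻¹ := by
  rw [latticeDispersion_coe]

/-- kernel: Δ^ξ((2π/ξ)x) = ξ^{−2}Σ_i 4 sin²(πx_i) (the symbol of −Δ^ξ at p = (2π/ξ)x, via 2 − 2cos 2a = 4 sin²a).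
[cite: Balaban1983Higgs3, (3.24) p.439] -/
theorem lapSymbol_smul (hξ : 0 < ξ) (x : Fin d → ℝ) :
    lapSymbol d ξ ((2 * Real.pi / ξ) • x) = ξ⁻¹ ^ 2 * ∑ i, 4 * Real.sin (Real.pi * x i) ^ 2 := by
  unfold lapSymbol
  rw [Finset.mul_sum]
  refine Finset.sum_congr rfl fun i _ => ?_
  have h1 : ξ * ((2 * Real.pi / ξ) • x) i = 2 * (Real.pi * x i) := by
    rw [Pi.smul_apply, smul_eq_mul]; field_simp
  rw [h1, Real.cos_two_mul, Real.cos_sq']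
  ring

/-- kernel: ξ·((2π/ξ)x)_μ = 2πx_μ. [folklore] -/
private theorem xi_mul_smul_apply (hξ : 0 < ξ) (x : Fin d → ℝ) (μ : Fin d) :
    ξ * ((2 * Real.pi / ξ) • x) μ = 2 * Real.pi * x μ := by
  rw [Pi.smul_apply, smul_eq_mul]; field_simp

/-- **C^ξ as Fourier coefficients of the symbol**: ξ^d C^ξ(y) = 𝓕_{T^d}[σ_ξ](y) (a real number), ξ > 0 — the momentum
integral (2π)^{−d}∫_{|p|≤π/ξ} cos(ξp·y)/(Δ^ξ(p)+1) dp of `Cxi` rewritten over the cube by p = (2π/ξ)θ.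
[cite: Balaban1983Higgs3, (3.16) p.437] -/
theorem mFourierCoeff_symb (hξ : 0 < ξ) (y : Fin d → ℤ) :
    mFourierCoeff (fun θ : UnitAddTorus (Fin d) => (((ξ⁻¹ ^ 2 * latticeDispersion θ + 1)⁻¹ : ℝ) : ℂ)) y =
      ((ξ ^ d * Cxi d ξ y : ℝ) : ℂ) := by
  have hint : Integrable (fun θ : UnitAddTorus (Fin d) => (ξ⁻¹ ^ 2 * latticeDispersion θ + 1)⁻¹) volume :=
    (continuous_symb ξ).integrable_unitAddTorus
  apply Complex.ext
  · -- real parts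
    rw [Complex.ofReal_re, mFourierCoeff_eq_integral_volume]
    have hi : Integrable (fun θ : UnitAddTorus (Fin d) =>
        mFourier (-y) θ • (((ξ⁻¹ ^ 2 * latticeDispersion θ + 1)⁻¹ : ℝ) : ℂ)) volume :=
      integrable_mFourier_smul_of_continuous (continuous_symbC ξ) y
    have hre := integral_re hi
    simp only [RCLike.re_to_complex] at hre
    rw [← hre]
    simp only [smul_eq_mul, Complex.re_mul_ofReal]
    rw [integral_torus_eq_cube]
    simp only [re_mFourier_coe, symb_coe]
    -- the `Cxi` side
    rw [Cxi, box_integral_eq_cube hξ, ← mul_assoc, mul_inv_cancel₀ (pow_ne_zero d hξ.ne'), one_mul]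
    refine integral_congr_ae (ae_of_all _ fun x => ?_)
    dsimp only
    rw [lapSymbol_smul hξ, div_eq_mul_inv]
    congr 1
    have h2 : ξ * ∑ μ : Fin d, ((2 * Real.pi / ξ) • x) μ * (y μ : ℝ) = -(2 * Real.pi * ∑ i, ((-y) i : ℝ) * x i) := by
      rw [Finset.mul_sum, Finset.mul_sum, ← Finset.sum_neg_distrib]
      refine Finset.sum_congr rfl fun i _ => ?_
      rw [Pi.smul_apply, smul_eq_mul, Pi.neg_apply, Int.cast_neg]
      field_simp
    rw [h2, Real.cos_neg]
  · -- imaginary parts vanish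
    rw [Complex.ofReal_im]
    exact im_mFourierCoeff_eq_zero_of_even hint (fun θ => by rw [latticeDispersion_neg]) y

end Symbol

/-! ## 4. (3.24), FIRST equality:
Σ_{x′} ξ^d(∂^ξ_μC^ξ)(x−x′)C^ξ(x−x′) = (2π)^{−d}∫_{|p|≤π/ξ} ξ^{−1}(cos ξp_μ − 1)/(Δ^ξ(p)+1)² dp -/

section Eq324

/-- kernel: 𝓕[e_{−e_μ}σ_ξ](y) = ξ^d C^ξ(y + e_μ) (shift of the Fourier coefficients). [cite: Balaban1983Higgs3, (3.24) p.439] -/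
private theorem mFourierCoeff_shift_symb (hξ : 0 < ξ) (μ : Fin d) (y : Fin d → ℤ) :
    mFourierCoeff (fun θ : UnitAddTorus (Fin d) => mFourier (-Pi.single μ 1) θ *
        (((ξ⁻¹ ^ 2 * latticeDispersion θ + 1)⁻¹ : ℝ) : ℂ)) y =
      ((ξ ^ d * Cxi d ξ (y + unitVec μ) : ℝ) : ℂ) := by
  rw [mFourierCoeff_mFourier_mul, sub_neg_eq_add, mFourierCoeff_symb hξ]
  rfl

/-- kernel: 𝓕[e_{e_μ}σ_ξ](y) = ξ^d C^ξ(y − e_μ). [cite: Balaban1983Higgs3, (3.28) p.441] -/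
private theorem mFourierCoeff_shift_symb' (hξ : 0 < ξ) (μ : Fin d) (y : Fin d → ℤ) :
    mFourierCoeff (fun θ : UnitAddTorus (Fin d) => mFourier (Pi.single μ 1) θ *
        (((ξ⁻¹ ^ 2 * latticeDispersion θ + 1)⁻¹ : ℝ) : ℂ)) y =
      ((ξ ^ d * Cxi d ξ (y - unitVec μ) : ℝ) : ℂ) := by
  rw [mFourierCoeff_mFourier_mul, mFourierCoeff_symb hξ]
  rfl

/-- kernel: the function Φ_μ = ξ^{−1}(e_{−e_μ} − 1)σ_ξ has Fourier coefficients ξ^d(∂^ξ_μC^ξ)(y).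
[cite: Balaban1983Higgs3, (3.24) p.439] -/
private theorem mFourierCoeff_pdiff_symb (hξ : 0 < ξ) (μ : Fin d) (y : Fin d → ℤ) :
    mFourierCoeff (((ξ⁻¹ : ℝ) : ℂ) • ((fun θ : UnitAddTorus (Fin d) => mFourier (-Pi.single μ 1) θ *
          (((ξ⁻¹ ^ 2 * latticeDispersion θ + 1)⁻¹ : ℝ) : ℂ)) -
        fun θ : UnitAddTorus (Fin d) => (((ξ⁻¹ ^ 2 * latticeDispersion θ + 1)⁻¹ : ℝ) : ℂ)))
        y = ((ξ ^ d * pdiffZ ξ⁻¹ μ (Cxi d ξ) y : ℝ) : ℂ) := by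
  have h1 : Integrable (fun θ : UnitAddTorus (Fin d) => mFourier (-Pi.single μ 1) θ *
      (((ξ⁻¹ ^ 2 * latticeDispersion θ + 1)⁻¹ : ℝ) : ℂ)) volume :=
    ((mFourier _).continuous.mul (continuous_symbC ξ)).integrable_unitAddTorus
  have h2 : Integrable (fun θ : UnitAddTorus (Fin d) => (((ξ⁻¹ ^ 2 * latticeDispersion θ + 1)⁻¹ : ℝ) : ℂ)) volume :=
    (continuous_symbC ξ).integrable_unitAddTorus
  rw [mFourierCoeff_const_smul, mFourierCoeff_sub h1 h2, mFourierCoeff_shift_symb hξ, mFourierCoeff_symb hξ]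
  simp only [pdiffZ, smul_eq_mul]
  push_cast
  ring

/-- kernel: Φ_μ is continuous. [folklore] -/
private theorem continuous_pdiff_symb (ξ : ℝ) (μ : Fin d) :
    Continuous (((ξ⁻¹ : ℝ) : ℂ) • ((fun θ : UnitAddTorus (Fin d) => mFourier (-Pi.single μ 1) θ *
          (((ξ⁻¹ ^ 2 * latticeDispersion θ + 1)⁻¹ : ℝ) : ℂ)) -
        fun θ : UnitAddTorus (Fin d) => (((ξ⁻¹ ^ 2 * latticeDispersion θ + 1)⁻¹ : ℝ) : ℂ))) :=
  (((mFourier _).continuous.mul (continuous_symbC ξ)).sub (continuous_symbC ξ)).const_smul _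

/-- kernel: the real part of conj(Φ_μ)·σ_ξ pointwise: ξ^{−1}(Re e_{e_μ} − 1)σ_ξ². [cite: Balaban1983Higgs3, (3.24) p.439] -/
private theorem re_conj_pdiff_symb_mul (ξ : ℝ) (μ : Fin d) (θ : UnitAddTorus (Fin d)) :
    (conj ((((ξ⁻¹ : ℝ) : ℂ) • ((fun θ : UnitAddTorus (Fin d) => mFourier (-Pi.single μ 1) θ *
          (((ξ⁻¹ ^ 2 * latticeDispersion θ + 1)⁻¹ : ℝ) : ℂ)) -
        fun θ : UnitAddTorus (Fin d) => (((ξ⁻¹ ^ 2 * latticeDispersion θ + 1)⁻¹ : ℝ) : ℂ))) θ) *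
        (((ξ⁻¹ ^ 2 * latticeDispersion θ + 1)⁻¹ : ℝ) : ℂ)).re =
      ξ⁻¹ * ((mFourier (Pi.single μ 1) θ).re - 1) * ((ξ⁻¹ ^ 2 * latticeDispersion θ + 1)⁻¹) ^ 2 := by
  simp only [Pi.smul_apply, Pi.sub_apply, smul_eq_mul, mFourier_neg, map_mul, map_sub, Complex.conj_conj,
    Complex.conj_ofReal]
  simp only [Complex.mul_re, Complex.mul_im, Complex.sub_re, Complex.sub_im, Complex.ofReal_re, Complex.ofReal_im]
  ring

/-- **(3.24)** p. 439 [PDF 29] of [Balaban1983Higgs3] (row B3.Eq3.21-3.24) — the named fact `Eq324` of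
`B3Sect3VectorSelfEnergy` PROVED for ξ > 0: its FIRST equality (Plancherel on ξℤ^d: the lattice sum Σ_{x′}ξ^d(∂^ξ_μC^ξ)(x−x′)
C^ξ(x−x′) equals the momentum integral (2π)^{−d}∫_{|p|≤π/ξ} dp ∂^ξ_μ(p)/(Δ^ξ(p)+1)², ∂^ξ_μ(p) read as ξ^{−1}(cos ξp_μ − 1), T4)
here, its SECOND equality by `eq324_rescale` (r15). [cite: Balaban1983Higgs3, (3.24) p.439] -/
theorem eq324_holds (hξ : 0 < ξ) : Eq324 d ξ := by
  intro μ x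
  refine ⟨?_, eq324_rescale hξ μ⟩
  -- reindex x′ ↦ y = x − x′
  have hre := (Equiv.subLeft x).tsum_eq fun y => ξ ^ d * (pdiffZ ξ⁻¹ μ (Cxi d ξ) y * Cxi d ξ y)
  simp only [Equiv.subLeft_apply] at hre
  rw [hre]
  -- Plancherel on T^d for Φ_μ and σ_ξ
  have hsum := (hasSum_mul_of_coeff (continuous_pdiff_symb ξ μ) (continuous_symbC ξ) (mFourierCoeff_pdiff_symb hξ μ)
    (mFourierCoeff_symb hξ)).mul_left ((ξ ^ d)⁻¹)
  have hfun : (fun y : Fin d → ℤ => (ξ ^ d)⁻¹ * (ξ ^ d * pdiffZ ξ⁻¹ μ (Cxi d ξ) y * (ξ ^ d * Cxi d ξ y))) =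
      fun y => ξ ^ d * (pdiffZ ξ⁻¹ μ (Cxi d ξ) y * Cxi d ξ y) := by
    funext y
    have hξd : ξ ^ d ≠ 0 := pow_ne_zero d hξ.ne'
    field_simp
  rw [hfun] at hsum
  rw [hsum.tsum_eq, box_integral_eq_cube hξ]
  congr 1
  simp_rw [re_conj_pdiff_symb_mul]
  rw [integral_torus_eq_cube]
  refine integral_congr_ae (ae_of_all _ fun x => ?_)
  dsimp only
  rw [(re_mFourier_single_coe μ x).1, lapSymbol_smul hξ, xi_mul_smul_apply hξ, latticeDispersion_coe, div_eq_mul_inv,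
    inv_pow]

end Eq324

/-! ## 5. (3.28), FIRST equality:
Σ_{y′} ξ^d(C^ξ(y′+ξe_μ) − C^ξ(y′−ξe_μ))(∂^ξ_{μ′}C^ξ)(y′) = 2(2π)^{−d}∫ ξ^{−1}sin ξp_μ sin ξp_{μ′}/(Δ^ξ(p)+1)² dp -/

section Eq328

/-- kernel: the function Ψ_μ = (e_{−e_μ} − e_{e_μ})σ_ξ has Fourier coefficients ξ^d(C^ξ(y+e_μ) − C^ξ(y−e_μ)).
[cite: Balaban1983Higgs3, (3.28) p.441] -/
private theorem mFourierCoeff_cdiff_symb (hξ : 0 < ξ) (μ : Fin d) (y : Fin d → ℤ) :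
    mFourierCoeff ((fun θ : UnitAddTorus (Fin d) => mFourier (-Pi.single μ 1) θ *
          (((ξ⁻¹ ^ 2 * latticeDispersion θ + 1)⁻¹ : ℝ) : ℂ)) -
        fun θ : UnitAddTorus (Fin d) => mFourier (Pi.single μ 1) θ *
          (((ξ⁻¹ ^ 2 * latticeDispersion θ + 1)⁻¹ : ℝ) : ℂ)) y =
      ((ξ ^ d * (Cxi d ξ (y + unitVec μ) - Cxi d ξ (y - unitVec μ)) : ℝ) : ℂ) := by
  have h1 : Integrable (fun θ : UnitAddTorus (Fin d) => mFourier (-Pi.single μ 1) θ *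
      (((ξ⁻¹ ^ 2 * latticeDispersion θ + 1)⁻¹ : ℝ) : ℂ)) volume :=
    ((mFourier _).continuous.mul (continuous_symbC ξ)).integrable_unitAddTorus
  have h2 : Integrable (fun θ : UnitAddTorus (Fin d) => mFourier (Pi.single μ 1) θ *
      (((ξ⁻¹ ^ 2 * latticeDispersion θ + 1)⁻¹ : ℝ) : ℂ)) volume :=
    ((mFourier _).continuous.mul (continuous_symbC ξ)).integrable_unitAddTorus
  rw [mFourierCoeff_sub h1 h2, mFourierCoeff_shift_symb hξ, mFourierCoeff_shift_symb' hξ]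
  push_cast
  ring

/-- kernel: Ψ_μ is continuous. [folklore] -/
private theorem continuous_cdiff_symb (ξ : ℝ) (μ : Fin d) :
    Continuous ((fun θ : UnitAddTorus (Fin d) => mFourier (-Pi.single μ 1) θ *
        (((ξ⁻¹ ^ 2 * latticeDispersion θ + 1)⁻¹ : ℝ) : ℂ)) -
        fun θ : UnitAddTorus (Fin d) => mFourier (Pi.single μ 1) θ *
          (((ξ⁻¹ ^ 2 * latticeDispersion θ + 1)⁻¹ : ℝ) : ℂ)) :=
  ((mFourier _).continuous.mul (continuous_symbC ξ)).sub ((mFourier _).continuous.mul (continuous_symbC ξ))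

/-- kernel: the real part of conj(Ψ_μ)·Φ_{μ′} pointwise: ξ^{−1}·2 Im e_{e_μ} Im e_{e_{μ′}}·σ_ξ²
((z − z̄)(w̄ − 1) has real part 2 Im z Im w for unit… any complex z, w). [cite: Balaban1983Higgs3, (3.28) p.441] -/
private theorem re_conj_cdiff_symb_mul (ξ : ℝ) (μ μ' : Fin d) (θ : UnitAddTorus (Fin d)) :
    (conj (((fun θ : UnitAddTorus (Fin d) => mFourier (-Pi.single μ 1) θ *
            (((ξ⁻¹ ^ 2 * latticeDispersion θ + 1)⁻¹ : ℝ) : ℂ)) -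
          fun θ : UnitAddTorus (Fin d) => mFourier (Pi.single μ 1) θ *
            (((ξ⁻¹ ^ 2 * latticeDispersion θ + 1)⁻¹ : ℝ) : ℂ)) θ) *
        (((ξ⁻¹ : ℝ) : ℂ) • ((fun θ : UnitAddTorus (Fin d) => mFourier (-Pi.single μ' 1) θ *
          (((ξ⁻¹ ^ 2 * latticeDispersion θ + 1)⁻¹ : ℝ) : ℂ)) -
        fun θ : UnitAddTorus (Fin d) => (((ξ⁻¹ ^ 2 * latticeDispersion θ + 1)⁻¹ : ℝ) : ℂ))) θ).re =
      ξ⁻¹ * (2 * (mFourier (Pi.single μ 1) θ).im * (mFourier (Pi.single μ' 1) θ).im) *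
        ((ξ⁻¹ ^ 2 * latticeDispersion θ + 1)⁻¹) ^ 2 := by
  simp only [Pi.smul_apply, Pi.sub_apply, smul_eq_mul, mFourier_neg, map_mul, map_sub, Complex.conj_conj,
    Complex.conj_ofReal]
  simp only [Complex.mul_re, Complex.mul_im, Complex.sub_re, Complex.sub_im, Complex.ofReal_re, Complex.ofReal_im,
    Complex.conj_re, Complex.conj_im]
  ring

/-- **(3.28)** p. 441 [PDF 31] of [Balaban1983Higgs3] (row B3.Eq3.25-3.32) — the named fact `Eq328` of
`B3Sect3VectorSelfEnergy` PROVED for ξ > 0: its FIRST equality (Plancherel on ξℤ^d: the lattice sum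
Σ_{y′}ξ^d(C^ξ(y′+ξe_μ) − C^ξ(y′−ξe_μ))(∂^ξ_{μ′}C^ξ)(y′) equals 2(2π)^{−d}∫_{|p|≤π/ξ} dp ξ^{−1} sin ξp_μ sin ξp_{μ′}/(Δ^ξ(p)+1)²)
here, its SECOND equality (the reflection/permutation symmetry giving (2/d)…δ_{μμ′}) by `eq328_second` (r15).
[cite: Balaban1983Higgs3, (3.28) p.441] -/
theorem eq328_holds (hξ : 0 < ξ) : Eq328 d ξ := by
  intro μ μ'
  refine ⟨?_, eq328_second hξ μ μ'⟩
  rw [sum328]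
  -- Plancherel on T^d for Ψ_μ and Φ_{μ′}
  have hsum := (hasSum_mul_of_coeff (continuous_cdiff_symb ξ μ) (continuous_pdiff_symb ξ μ')
    (mFourierCoeff_cdiff_symb hξ μ) (mFourierCoeff_pdiff_symb hξ μ')).mul_left ((ξ ^ d)⁻¹)
  have hfun : (fun y : Fin d → ℤ => (ξ ^ d)⁻¹ *
      (ξ ^ d * (Cxi d ξ (y + unitVec μ) - Cxi d ξ (y - unitVec μ)) * (ξ ^ d * pdiffZ ξ⁻¹ μ' (Cxi d ξ) y))) =
      fun y => ξ ^ d * ((Cxi d ξ (y + unitVec μ) - Cxi d ξ (y - unitVec μ)) * pdiffZ ξ⁻¹ μ' (Cxi d ξ) y) := by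
    funext y
    have hξd : ξ ^ d ≠ 0 := pow_ne_zero d hξ.ne'
    field_simp
  rw [hfun] at hsum
  rw [hsum.tsum_eq, mul_assoc, box_integral_eq_cube hξ, mul_left_comm]
  congr 1
  rw [← integral_const_mul]
  simp_rw [re_conj_cdiff_symb_mul]
  rw [integral_torus_eq_cube]
  refine integral_congr_ae (ae_of_all _ fun x => ?_)
  dsimp only
  rw [(re_mFourier_single_coe μ x).2, (re_mFourier_single_coe μ' x).2, lapSymbol_smul hξ, xi_mul_smul_apply hξ,
    xi_mul_smul_apply hξ, latticeDispersion_coe, div_eq_mul_inv, inv_pow]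
  ring

end Eq328






/-! ## 6. (v1.1, append-only) (3.38) p. 444, the printed chain FOR C^ξ ITSELF: first member = last member (= 0) -/

section Eq338

/-- `𝓕(conj G)(k) = conj 𝓕G(−k)`. [folklore] -/
private theorem mFourierCoeff_conj (G : UnitAddTorus (Fin d) → ℂ) (k : Fin d → ℤ) :
    mFourierCoeff (fun θ => conj (G θ)) k = conj (mFourierCoeff G (-k)) := by
  rw [mFourierCoeff_eq_integral_volume, mFourierCoeff_eq_integral_volume, ← integral_conj]
  refine integral_congr_ae (ae_of_all _ fun θ => ?_)
  simp only [smul_eq_mul, map_mul, neg_neg, mFourier_neg]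

/-- **Convolution theorem on T^d** (coefficient form): Σ_v 𝓕G(w − v)𝓕H(v) = 𝓕[GH](w) as a `HasSum`, for continuous G, H
(the polarised Plancherel identity applied to e_w·conj G and H). [folklore] -/
private theorem hasSum_coeff_conv {G H : UnitAddTorus (Fin d) → ℂ} (hG : Continuous G) (hH : Continuous H)
    (w : Fin d → ℤ) :
    HasSum (fun v => mFourierCoeff G (w - v) * mFourierCoeff H v) (mFourierCoeff (fun θ => G θ * H θ) w) := by
  have hK : Continuous fun θ : UnitAddTorus (Fin d) => mFourier w θ * conj (G θ) :=
    (mFourier w).continuous.mul (Complex.continuous_conj.comp hG)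
  have h := hasSum_conj_mul_mFourierCoeff (memLp_two_of_continuous hK) (memLp_two_of_continuous hH)
  have h1 : ∀ v, conj (mFourierCoeff (fun θ : UnitAddTorus (Fin d) => mFourier w θ * conj (G θ)) v) =
      mFourierCoeff G (w - v) := by
    intro v
    rw [mFourierCoeff_mFourier_mul (fun θ => conj (G θ)) w v, mFourierCoeff_conj, Complex.conj_conj, neg_sub]
  have h2 : (∫ θ, conj (mFourier w θ * conj (G θ)) * H θ) = mFourierCoeff (fun θ => G θ * H θ) w := by
    rw [mFourierCoeff_eq_integral_volume]
    refine integral_congr_ae (ae_of_all _ fun θ => ?_)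
    simp only [map_mul, Complex.conj_conj, smul_eq_mul, mFourier_neg, mul_assoc]
  simp only [h1] at h
  rwa [h2] at h

/-- kernel: the characters cancel — translation invariance: 𝓕[α·β·e_{y′}·σ](y′) = ∫ αβσ. [folklore] -/
private theorem mFourierCoeff_cancel (α β σ : UnitAddTorus (Fin d) → ℂ) (y' : Fin d → ℤ) :
    mFourierCoeff (fun θ => α θ * (β θ * (mFourier y' θ * σ θ))) y' = ∫ θ, α θ * β θ * σ θ := by
  rw [mFourierCoeff_eq_integral_volume]
  refine integral_congr_ae (ae_of_all _ fun θ => ?_)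
  have h1 : mFourier (-y') θ * mFourier y' θ = 1 := by
    rw [← mFourier_add, neg_add_cancel, mFourier_zero]; rfl
  calc mFourier (-y') θ • (α θ * (β θ * (mFourier y' θ * σ θ)))
      = (mFourier (-y') θ * mFourier y' θ) * (α θ * β θ * σ θ) := by rw [smul_eq_mul]; ring
    _ = α θ * β θ * σ θ := by rw [h1, one_mul]

/-- kernel: the multiplier functions ξ^{−1}(e_m − 1)F are continuous. [folklore] -/
private theorem continuous_mulShift {F : UnitAddTorus (Fin d) → ℂ} (hF : Continuous F) (c : ℂ) (m : Fin d → ℤ) :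
    Continuous (c • ((fun θ : UnitAddTorus (Fin d) => mFourier m θ * F θ) - F)) :=
  (((mFourier m).continuous.mul hF).sub hF).const_smul c

/-- **Difference quotients ↔ multipliers** (forward): if s·f = 𝓕F then s·(∂^ξ_μ f) = 𝓕[c(e_{−e_μ} − 1)F], c = ξ^{−1}.
[cite: Balaban1983Higgs3, (3.27) p.441] -/
private theorem coeff_pdiffZ {F : UnitAddTorus (Fin d) → ℂ} (hF : Continuous F) {f : (Fin d → ℤ) → ℝ} {s : ℝ}
    (hf : ∀ y, ((s * f y : ℝ) : ℂ) = mFourierCoeff F y) (c : ℝ) (μ : Fin d) (y : Fin d → ℤ) :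
    ((s * pdiffZ c μ f y : ℝ) : ℂ) =
      mFourierCoeff (((c : ℝ) : ℂ) • ((fun θ : UnitAddTorus (Fin d) => mFourier (-Pi.single μ 1) θ * F θ) - F)) y := by
  have h1 : Integrable (fun θ : UnitAddTorus (Fin d) => mFourier (-Pi.single μ 1) θ * F θ) volume :=
    ((mFourier _).continuous.mul hF).integrable_unitAddTorus
  rw [mFourierCoeff_const_smul, mFourierCoeff_sub h1 hF.integrable_unitAddTorus, mFourierCoeff_mFourier_mul,
    sub_neg_eq_add, ← hf, ← hf y]
  simp only [pdiffZ, smul_eq_mul, unitVec]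
  push_cast
  ring

/-- **Difference quotients ↔ multipliers** (backward): if s·f = 𝓕F then s·(∂^{ξ*}_μ f) = 𝓕[c(e_{e_μ} − 1)F], c = ξ^{−1}.
[cite: Balaban1983Higgs3, (3.27) p.441] -/
private theorem coeff_pdiffAdjZ {F : UnitAddTorus (Fin d) → ℂ} (hF : Continuous F) {f : (Fin d → ℤ) → ℝ} {s : ℝ}
    (hf : ∀ y, ((s * f y : ℝ) : ℂ) = mFourierCoeff F y) (c : ℝ) (μ : Fin d) (y : Fin d → ℤ) :
    ((s * pdiffAdjZ c μ f y : ℝ) : ℂ) =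
      mFourierCoeff (((c : ℝ) : ℂ) • ((fun θ : UnitAddTorus (Fin d) => mFourier (Pi.single μ 1) θ * F θ) - F)) y := by
  have h1 : Integrable (fun θ : UnitAddTorus (Fin d) => mFourier (Pi.single μ 1) θ * F θ) volume :=
    ((mFourier _).continuous.mul hF).integrable_unitAddTorus
  rw [mFourierCoeff_const_smul, mFourierCoeff_sub h1 hF.integrable_unitAddTorus, mFourierCoeff_mFourier_mul, ← hf,
    ← hf y]
  simp only [pdiffAdjZ, smul_eq_mul, unitVec]
  push_cast
  ring

/-- kernel: the shifted symbol carries the re-centred propagator: ξ^d C^ξ(y′ − v) = 𝓕[e_{y′}σ_ξ](v) (evenness of C^ξ).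
[cite: Balaban1983Higgs3, (3.27) p.441] -/
private theorem coeff_shift_symb (hξ : 0 < ξ) (y' v : Fin d → ℤ) :
    ((ξ ^ d * Cxi d ξ (y' - v) : ℝ) : ℂ) =
      mFourierCoeff (fun θ : UnitAddTorus (Fin d) =>
        mFourier y' θ * (((ξ⁻¹ ^ 2 * latticeDispersion θ + 1)⁻¹ : ℝ) : ℂ)) v := by
  rw [mFourierCoeff_mFourier_mul, mFourierCoeff_symb hξ, ← Cxi_neg ξ (y' - v), neg_sub]

/-- **The double sum of (3.38) by two applications of the convolution theorem**: for continuous α, β, σ with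
s·A = 𝓕α, s·B = 𝓕β, s·C(y′ − ·) = 𝓕[e_{y′}σ] (s ≠ 0), the inner sums Σ_{y″} A(y′−y)B(y−y″)C(y′−y″) converge to
W(y) = A(y′−y)·s^{−2}𝓕[β e_{y′} σ](y) and Σ_y W(y) = s^{−3}∫_{T^d} αβσ. [folklore] -/
private theorem hasSum_triple {α β σ : UnitAddTorus (Fin d) → ℂ} (hα : Continuous α) (hβ : Continuous β)
    (hσ : Continuous σ) {A B C : (Fin d → ℤ) → ℝ} {s : ℝ} (hs : s ≠ 0)
    (hA : ∀ y, ((s * A y : ℝ) : ℂ) = mFourierCoeff α y) (hB : ∀ y, ((s * B y : ℝ) : ℂ) = mFourierCoeff β y) {y' : Fin d → ℤ}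
    (hC : ∀ v, ((s * C (y' - v) : ℝ) : ℂ) = mFourierCoeff (fun θ => mFourier y' θ * σ θ) v) :
    (∀ y, HasSum (fun y'' => (A (y' - y) : ℂ) * B (y - y'') * C (y' - y''))
        ((A (y' - y) : ℂ) * (((s⁻¹ ^ 2 : ℝ) : ℂ) * mFourierCoeff (fun θ => β θ * (mFourier y' θ * σ θ)) y))) ∧
      HasSum (fun y => (A (y' - y) : ℂ) * (((s⁻¹ ^ 2 : ℝ) : ℂ) * mFourierCoeff (fun θ => β θ * (mFourier y' θ * σ θ)) y))
        (((s⁻¹ ^ 3 : ℝ) : ℂ) * ∫ θ, α θ * β θ * σ θ) := by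
  have hγ : Continuous fun θ : UnitAddTorus (Fin d) => β θ * (mFourier y' θ * σ θ) :=
    hβ.mul ((mFourier y').continuous.mul hσ)
  have hs' : (s : ℂ) ≠ 0 := Complex.ofReal_ne_zero.2 hs
  constructor
  · intro y
    have h := ((hasSum_coeff_conv hβ ((mFourier y').continuous.mul hσ) y).mul_left (((s⁻¹ ^ 2 : ℝ) : ℂ))).mul_left
      (A (y' - y) : ℂ)
    have hfun : (fun y'' => (A (y' - y) : ℂ) * B (y - y'') * C (y' - y'')) = fun y'' =>
        (A (y' - y) : ℂ) * ((((s⁻¹ ^ 2 : ℝ) : ℂ)) * (mFourierCoeff β (y - y'') *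
          mFourierCoeff (fun θ => mFourier y' θ * σ θ) y'')) := by
      funext y''
      rw [← hB, ← hC]
      push_cast
      field_simp
    rw [hfun]
    exact h
  · have h := (hasSum_coeff_conv hα hγ y').mul_left (((s⁻¹ ^ 3 : ℝ) : ℂ))
    rw [mFourierCoeff_cancel] at h
    have hfun : (fun y => (A (y' - y) : ℂ) * (((s⁻¹ ^ 2 : ℝ) : ℂ) *
        mFourierCoeff (fun θ => β θ * (mFourier y' θ * σ θ)) y)) = fun y =>
        ((s⁻¹ ^ 3 : ℝ) : ℂ) * (mFourierCoeff α (y' - y) * mFourierCoeff (fun θ => β θ * (mFourier y' θ * σ θ)) y) := by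
      funext y
      rw [← hA]
      push_cast
      field_simp
    rw [hfun]
    exact h

/-- kernel: if Re(αβσ) = Re(δεσ) pointwise (all continuous) then Re ∫αβσ = Re ∫δεσ. [folklore] -/
private theorem re_integral_sub_eq_zero {α β σ δ ε : UnitAddTorus (Fin d) → ℂ} (hα : Continuous α) (hβ : Continuous β)
    (hσ : Continuous σ) (hδ : Continuous δ) (hε : Continuous ε)
    (h : ∀ θ, (α θ * β θ * σ θ).re = (δ θ * ε θ * σ θ).re) :
    ((∫ θ, α θ * β θ * σ θ) - ∫ θ, δ θ * ε θ * σ θ).re = 0 := by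
  have i1 : Integrable (fun θ => α θ * β θ * σ θ) volume := ((hα.mul hβ).mul hσ).integrable_unitAddTorus
  have i2 : Integrable (fun θ => δ θ * ε θ * σ θ) volume := ((hδ.mul hε).mul hσ).integrable_unitAddTorus
  have h1 := integral_re i1
  have h2 := integral_re i2
  simp only [RCLike.re_to_complex] at h1 h2
  rw [Complex.sub_re, ← h1, ← h2, sub_eq_zero]
  exact integral_congr_ae (ae_of_all _ h)

/-- **(3.38)** p. 444 [PDF 34] of [Balaban1983Higgs3] (row B3.Eq3.33-3.38), the printed chain FOR C^ξ ITSELF — the named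
fact `B3Sect3TriangleGraphs.Eq338` PROVED for ξ > 0: the first member −q³Σ_{y,y″}ξ^{2d}Σ_ν[(∂^ξ_νC^ξ)(y′−y)(∂^ξ_μC^ξ∂^{ξ*}_ν)
(y−y″)C^ξ(y′−y″) − (∂^ξ_νC^ξ∂^{ξ*}_μ)(y′−y)(C^ξ∂^{ξ*}_ν)(y−y″)C^ξ(y′−y″)] equals the last member, which is 0
(`last338_Cxi_eq_zero`, r15: *"because the functions which we are summing are odd"*).  Proof (momentum space instead of the
printed summation by parts with (3.16)): by the convolution theorem on T^d applied twice (`hasSum_triple`; the characters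
e_{±y′} cancel — translation invariance) the iterated sum is −q³ξ^{2d}ξ^{−3d}Σ_ν∫_{T^d}[Φ_νB_{μν} − D_{νμ}Ψ_ν]σ_ξ dθ with the
multipliers of ∂^ξ, ∂^{ξ*} (`coeff_pdiffZ`, `coeff_pdiffAdjZ`); pointwise this integrand is ξ^{−3}|e_{e_ν} − 1|²σ_ξ³(ē_{e_μ} − e_{e_μ}),
purely imaginary, while the sum is real — hence both vanish. [cite: Balaban1983Higgs3, (3.38) p.444] -/
theorem eq338_holds (hξ : 0 < ξ) (q3 : ℝ) : B3Sect3TriangleGraphs.Eq338 d ξ q3 := by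
  intro y' μ
  rw [B3Sect3TriangleGraphs.last338_Cxi_eq_zero]
  have hσ := continuous_symbC (d := d) ξ
  have hC : ∀ y, ((ξ ^ d * Cxi d ξ y : ℝ) : ℂ) =
      mFourierCoeff (fun θ : UnitAddTorus (Fin d) => (((ξ⁻¹ ^ 2 * latticeDispersion θ + 1)⁻¹ : ℝ) : ℂ)) y :=
    fun y => (mFourierCoeff_symb hξ y).symm
  have hs : ξ ^ d ≠ 0 := pow_ne_zero d hξ.ne'
  -- the five kernels as Fourier coefficients of continuous multiplier functions
  have hA := fun ν : Fin d => coeff_pdiffZ hσ hC ξ⁻¹ ν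
  have hE := fun ν : Fin d => coeff_pdiffAdjZ hσ hC ξ⁻¹ ν
  have hΨc := fun ν : Fin d => continuous_mulShift hσ (((ξ⁻¹ : ℝ) : ℂ)) (Pi.single ν 1)
  have hΦc := fun ν : Fin d => continuous_mulShift hσ (((ξ⁻¹ : ℝ) : ℂ)) (-Pi.single ν 1)
  have hB := fun ν : Fin d => coeff_pdiffZ (hΨc ν) (hE ν) ξ⁻¹ μ
  have hD := fun ν : Fin d => coeff_pdiffZ (hΨc μ) (hE μ) ξ⁻¹ ν
  have hBc := fun ν : Fin d => continuous_mulShift (hΨc ν) (((ξ⁻¹ : ℝ) : ℂ)) (-Pi.single μ 1)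
  have hDc := fun ν : Fin d => continuous_mulShift (hΨc μ) (((ξ⁻¹ : ℝ) : ℂ)) (-Pi.single ν 1)
  have hCs := coeff_shift_symb hξ y'
  -- the two triple sums, ν by ν
  have T1 := fun ν : Fin d => hasSum_triple (hΦc ν) (hBc ν) hσ hs (hA ν) (hB ν) hCs
  have T2 := fun ν : Fin d => hasSum_triple (hDc ν) (hΨc ν) hσ hs (hD ν) (hE ν) hCs
  -- inner sums (y fixed), then the outer sum
  have hin := fun y : Fin d → ℤ =>
    (hasSum_sum (s := Finset.univ) fun ν _ => ((T1 ν).1 y).sub ((T2 ν).1 y)).mul_left (((ξ ^ (2 * d) : ℝ)) : ℂ)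
  have hout := (hasSum_sum (s := Finset.univ) fun ν _ => (T1 ν).2.sub (T2 ν).2).mul_left (((ξ ^ (2 * d) : ℝ)) : ℂ)
  -- the printed double sum, cast to ℂ, is the outer sum's value
  have hc : ((B3Sect3TriangleGraphs.lhs338 ξ q3 (Cxi d ξ) y' μ : ℝ) : ℂ) =
      -(q3 : ℂ) * ∑' y : Fin d → ℤ, ∑' y'' : Fin d → ℤ, ((ξ ^ (2 * d) : ℝ) : ℂ) * ∑ ν : Fin d,
        ((pdiffZ ξ⁻¹ ν (Cxi d ξ) (y' - y) : ℂ) * (pdiffZ ξ⁻¹ μ (pdiffAdjZ ξ⁻¹ ν (Cxi d ξ)) (y - y'') : ℂ) *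
            (Cxi d ξ (y' - y'') : ℂ) -
          (pdiffZ ξ⁻¹ ν (pdiffAdjZ ξ⁻¹ μ (Cxi d ξ)) (y' - y) : ℂ) * (pdiffAdjZ ξ⁻¹ ν (Cxi d ξ) (y - y'') : ℂ) *
            (Cxi d ξ (y' - y'') : ℂ)) := by
    simp only [B3Sect3TriangleGraphs.lhs338, Complex.ofReal_mul, Complex.ofReal_neg, Complex.ofReal_tsum,
      Complex.ofReal_sum, Complex.ofReal_sub]
  rw [tsum_congr fun y => (hin y).tsum_eq, hout.tsum_eq] at hc
  -- real parts: each ν-term is k·(∫f₁ − ∫f₂) with Re f₁ = Re f₂ pointwise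
  have key := fun ν : Fin d => re_integral_sub_eq_zero (hΦc ν) (hBc ν) hσ (hDc ν) (hΨc ν)
    (fun θ => by
      simp only [Pi.smul_apply, Pi.sub_apply, smul_eq_mul, mFourier_neg]
      simp only [Complex.mul_re, Complex.mul_im, Complex.sub_re, Complex.sub_im, Complex.ofReal_re,
        Complex.ofReal_im, Complex.conj_re, Complex.conj_im]
      ring)
  have hfinal : (((B3Sect3TriangleGraphs.lhs338 ξ q3 (Cxi d ξ) y' μ : ℝ) : ℂ)).re = 0 := by
    rw [hc, ← Complex.ofReal_neg, Complex.re_ofReal_mul, Complex.re_ofReal_mul, Complex.re_sum,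
      Finset.sum_eq_zero, mul_zero, mul_zero]
    intro ν _
    rw [← mul_sub, Complex.re_ofReal_mul, key ν, mul_zero]
  simpa using hfinal

end Eq338


/-! ## 7. (v1.2, append-only) (3.24) p. 439: *"the expression on the right side has a finite limit as ξ → 0"* (d = 2, 3) -/

section Limit324

open Topology
open scoped ENNReal

/-- kernel: Δ¹(p) = Σ_ν (2 − 2cos p_ν). [cite: Balaban1983Higgs3, (3.24) p.439] -/
private theorem lapSymbol_one (p : Fin d → ℝ) : lapSymbol d 1 p = ∑ ν, (2 - 2 * Real.cos (p ν)) := by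
  simp [lapSymbol]

/-- kernel: one term of Δ¹: 2 − 2cos p_μ ≤ Δ¹(p). [cite: Balaban1983Higgs3, (3.24) p.439] -/
private theorem two_sub_two_cos_le_lapSymbol (p : Fin d → ℝ) (μ : Fin d) : 2 - 2 * Real.cos (p μ) ≤ lapSymbol d 1 p := by
  rw [lapSymbol_one]
  exact Finset.single_le_sum (f := fun ν => 2 - 2 * Real.cos (p ν))
    (fun ν _ => by linarith [Real.cos_le_one (p ν)]) (Finset.mem_univ μ)

/-- kernel: Δ^ξ is continuous in p. [folklore] -/
private theorem continuous_lapSymbol (d : ℕ) (ξ : ℝ) : Continuous (lapSymbol d ξ) := by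
  unfold lapSymbol
  exact continuous_finsetSum _ fun ν _ =>
    continuous_const.mul (continuous_const.sub (continuous_const.mul
      (Real.continuous_cos.comp (continuous_const.mul (continuous_apply ν)))))

/-- kernel: the integrand of (3.24)'s right side is measurable in p′ for every ξ. [folklore] -/
private theorem measurable_integrand324 (μ : Fin d) (ξ : ℝ) :
    Measurable fun p : Fin d → ℝ => (Real.cos (p μ) - 1) / (lapSymbol d 1 p + ξ ^ 2) ^ 2 :=
  ((Real.continuous_cos.comp (continuous_apply μ)).sub continuous_const).measurable.div
    (((continuous_lapSymbol d 1).add continuous_const).pow 2).measurable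

/-- **Pointwise domination** of the integrand of (3.24)'s right side, uniformly in ξ:
|(cos p′_μ − 1)/(Δ¹(p′)+ξ²)²| ≤ 1/(2Δ¹(p′)) (from 1 − cos p′_μ ≤ ½Δ¹(p′)). [cite: Balaban1983Higgs3, (3.24) p.439] -/
private theorem abs_integrand324_le (μ : Fin d) (ξ : ℝ) (p : Fin d → ℝ) :
    |(Real.cos (p μ) - 1) / (lapSymbol d 1 p + ξ ^ 2) ^ 2| ≤ (2 * lapSymbol d 1 p)⁻¹ := by
  have hΛ := lapSymbol_nonneg d 1 p
  have hc := two_sub_two_cos_le_lapSymbol p μ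
  rcases hΛ.eq_or_lt with h0 | hpos
  · -- Δ¹(p) = 0 forces cos p_μ = 1
    have hcos : Real.cos (p μ) - 1 = 0 := by linarith [Real.cos_le_one (p μ)]
    rw [hcos, zero_div, abs_zero, ← h0, mul_zero, inv_zero]
  · rw [abs_div, abs_of_nonpos (by linarith [Real.cos_le_one (p μ)]), abs_of_nonneg (sq_nonneg _), neg_sub]
    calc (1 - Real.cos (p μ)) / (lapSymbol d 1 p + ξ ^ 2) ^ 2
        ≤ (1 - Real.cos (p μ)) / (lapSymbol d 1 p) ^ 2 :=
          div_le_div_of_nonneg_left (by linarith [Real.cos_le_one (p μ)]) (pow_pos hpos 2)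
            (pow_le_pow_left₀ hΛ (le_add_of_nonneg_right (sq_nonneg ξ)) 2)
      _ ≤ (lapSymbol d 1 p / 2) / (lapSymbol d 1 p) ^ 2 :=
          div_le_div_of_nonneg_right (by linarith) (sq_nonneg _)
      _ = (2 * lapSymbol d 1 p)⁻¹ := by field_simp

/-- kernel: the box |p_μ| ≤ π/ξ is measurable. [folklore] -/
private theorem measurableSet_bzBox' (d : ℕ) (ξ : ℝ) : MeasurableSet (bzBox d ξ) := by
  have h : bzBox d ξ = ⋂ μ : Fin d, {p : Fin d → ℝ | |p μ| ≤ Real.pi / ξ} := by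
    ext p; simp only [bzBox, mem_setOf_eq, mem_iInter]
  rw [h]
  exact MeasurableSet.iInter fun μ => (isClosed_le (continuous_apply μ).abs continuous_const).measurableSet

/-- **Integrability transport box ← torus** (in `ℝ≥0∞`): a measurable G on the box |p_μ| ≤ π/ξ whose pull-back to the cube
by p = (2π/ξ)x is dominated by the lift of an integrable g on T^d is integrable on the box. [folklore] -/
private theorem integrableOn_bzBox_of_torus (hξ : 0 < ξ) {G : (Fin d → ℝ) → ℝ} (hGm : Measurable G)
    {g : UnitAddTorus (Fin d) → ℝ} (hg : Integrable g volume)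
    (hle : ∀ x : Fin d → ℝ, ‖G ((2 * Real.pi / ξ) • x)‖ ≤ ‖g (fun i => ((x i : ℝ) : UnitAddCircle))‖) :
    IntegrableOn G (bzBox d ξ) volume := by
  have hR : 0 < 2 * Real.pi / ξ := div_pos Real.two_pi_pos hξ
  have hmeasIcc : MeasurableSet {x : Fin d → ℝ | ∀ i, x i ∈ Icc (-(1 / 2 : ℝ)) (-(1 / 2) + 1)} := by
    rw [iccCube_eq_pi]; exact MeasurableSet.univ_pi fun _ => measurableSet_Icc
  refine ⟨hGm.aestronglyMeasurable, ?_⟩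
  unfold HasFiniteIntegral
  -- pull back to the cube
  set H : (Fin d → ℝ) → ℝ≥0∞ := (bzBox d ξ).indicator fun p => ‖G p‖ₑ with hH
  have hind : (fun x : Fin d → ℝ => H ((2 * Real.pi / ξ) • x)) =
      {x : Fin d → ℝ | ∀ i, x i ∈ Icc (-(1 / 2 : ℝ)) (-(1 / 2) + 1)}.indicator
        (fun x => ‖G ((2 * Real.pi / ξ) • x)‖ₑ) := by
    funext x
    rw [hH, ← preimage_smul_bzBox hξ]
    rfl
  have hcube : ∫⁻ x, H ((2 * Real.pi / ξ) • x) < ∞ := by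
    rw [hind, lintegral_indicator hmeasIcc]
    have hae : {x : Fin d → ℝ | ∀ i, x i ∈ Ioc (-(1 / 2 : ℝ)) (-(1 / 2) + 1)} =ᵐ[volume]
        {x : Fin d → ℝ | ∀ i, x i ∈ Icc (-(1 / 2 : ℝ)) (-(1 / 2) + 1)} := by
      rw [iocCube_eq_pi, iccCube_eq_pi, MeasureTheory.volume_pi]
      exact Measure.pi_Ioc_ae_eq_pi_Icc
    rw [← setLIntegral_congr hae]
    calc ∫⁻ x in {x : Fin d → ℝ | ∀ i, x i ∈ Ioc (-(1 / 2 : ℝ)) (-(1 / 2) + 1)}, ‖G ((2 * Real.pi / ξ) • x)‖ₑ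
        ≤ ∫⁻ x in {x : Fin d → ℝ | ∀ i, x i ∈ Ioc (-(1 / 2 : ℝ)) (-(1 / 2) + 1)},
            ‖g (fun i => ((x i : ℝ) : UnitAddCircle))‖ₑ := by
          refine lintegral_mono fun x => ?_
          rw [← ofReal_norm, ← ofReal_norm]
          exact ENNReal.ofReal_le_ofReal (hle x)
      _ = ∫⁻ θ, ‖g θ‖ₑ := (Torus.lintegral_eq_lintegral_cube fun θ => ‖g θ‖ₑ).symm
      _ < ∞ := hg.2
  -- Lebesgue scaling on ℝ^d
  have hcv := lintegral_comp_smul volume H hR.ne'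
  rw [Module.finrank_fin_fun] at hcv
  have hc0 : ENNReal.ofReal |((2 * Real.pi / ξ) ^ d)⁻¹| ≠ 0 :=
    (ENNReal.ofReal_pos.2 (abs_pos.2 (inv_ne_zero (pow_ne_zero d hR.ne')))).ne'
  rw [hcv] at hcube
  rw [← lintegral_indicator (measurableSet_bzBox' d ξ)]
  rcases ENNReal.mul_lt_top_iff.1 hcube with ⟨_, h2⟩ | h0 | h0
  · exact h2
  · exact absurd h0 hc0
  · rw [h0]; exact ENNReal.zero_lt_top

/-- kernel: **μ^{−3/4} ∈ L¹(T²)** (on the cube μ(x) ≥ 16‖x‖², so μ^{−3/4} ≤ 16^{−3/4}‖x‖^{−3/2}, and 3/2 < 2). [folklore] -/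
private theorem integrable_rpow_latticeDispersion_two :
    Integrable (fun θ : UnitAddTorus (Fin 2) => (latticeDispersion θ) ^ (-(3 / 4 : ℝ))) volume := by
  have hmeas : AEStronglyMeasurable (fun θ : UnitAddTorus (Fin 2) => (latticeDispersion θ) ^ (-(3 / 4 : ℝ))) volume :=
    (continuous_latticeDispersion.measurable.pow_const _).aestronglyMeasurable
  refine ⟨hmeas, ?_⟩
  set cube : Set (Fin 2 → ℝ) := {x | ∀ i, x i ∈ Ioc (-(1 / 2 : ℝ)) (-(1 / 2) + 1)} with hcube
  have hcm : MeasurableSet cube := MeasurableSet.univ_pi' fun i => measurableSet_Ioc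
  set g : (Fin 2 → ℝ) → ℝ := cube.indicator fun x =>
    (latticeDispersion (fun i => ((x i : ℝ) : UnitAddCircle))) ^ (-(3 / 4 : ℝ)) with hg
  have hgm : AEStronglyMeasurable g volume := by
    refine (Measurable.indicator ?_ hcm).aestronglyMeasurable
    exact ((continuous_latticeDispersion.comp (continuous_pi fun i =>
      (AddCircle.continuous_mk' 1).comp (continuous_apply i))).measurable.pow_const _)
  have hdim : (3 / 2 : ℝ) < Module.finrank ℝ (Fin 2 → ℝ) := by
    rw [Module.finrank_fin_fun]; norm_num
  have hdim1 : 1 ≤ Module.finrank ℝ (Fin 2 → ℝ) := by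
    rw [Module.finrank_fin_fun]; norm_num
  have hint : IntegrableOn g (Metric.ball (0 : Fin 2 → ℝ) 1) volume := by
    refine integrableOn_ball_of_norm_le_rpow hdim1 (C := (16 : ℝ) ^ (-(3 / 4 : ℝ))) hdim
      (ae_of_all _ fun x => ?_) hgm
    rw [hg]
    by_cases hx : x ∈ cube
    · rw [indicator_of_mem hx, Real.norm_eq_abs, abs_of_nonneg (Real.rpow_nonneg (latticeDispersion_nonneg _) _)]
      by_cases h0 : x = 0
      · subst h0
        have : latticeDispersion (fun i : Fin 2 => (((0 : Fin 2 → ℝ) i : ℝ) : UnitAddCircle)) = 0 := by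
          rw [latticeDispersion_coe]; simp
        rw [this, Real.zero_rpow (by norm_num)]
        positivity
      · have hpos : 0 < ‖x‖ := norm_pos_iff.2 h0
        have hle := norm_sq_le_latticeDispersion (abs_le_of_mem_cube hx)
        have h16 : (0 : ℝ) < 16 * ‖x‖ ^ 2 := by positivity
        calc latticeDispersion (fun i => ((x i : ℝ) : UnitAddCircle)) ^ (-(3 / 4 : ℝ))
            ≤ (16 * ‖x‖ ^ 2) ^ (-(3 / 4 : ℝ)) := Real.rpow_le_rpow_of_nonpos h16 hle (by norm_num)
          _ = (16 : ℝ) ^ (-(3 / 4 : ℝ)) * ‖x‖ ^ (-(3 / 2 : ℝ)) := by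
              rw [Real.mul_rpow (by norm_num) (sq_nonneg _), show (‖x‖ ^ 2 : ℝ) = ‖x‖ ^ (2 : ℝ) by norm_cast,
                ← Real.rpow_mul hpos.le]
              norm_num
    · rw [indicator_of_notMem hx, norm_zero]
      positivity
  have hint' : IntegrableOn g cube volume := hint.mono_set cube_subset_ball
  have hfin : ∫⁻ x in cube, ‖g x‖ₑ < ∞ := hint'.2
  have htrans := UnitAddTorus.lintegral_preimage
    (fun θ : UnitAddTorus (Fin 2) => ‖(latticeDispersion θ) ^ (-(3 / 4 : ℝ))‖ₑ) (fun _ : Fin 2 => -(1 / 2 : ℝ))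
  have hcongr : ∫⁻ x in cube, ‖(latticeDispersion (fun i => ((x i : ℝ) : UnitAddCircle))) ^ (-(3 / 4 : ℝ))‖ₑ =
      ∫⁻ x in cube, ‖g x‖ₑ :=
    setLIntegral_congr_fun hcm fun x hx => by rw [hg, indicator_of_mem hx]
  unfold HasFiniteIntegral
  rw [volume_eq_pi_haarAddCircle]
  exact lt_of_eq_of_lt (htrans.trans hcongr) hfin

/-- kernel: 1/(2Δ¹) is integrable on the box |p_μ| ≤ π in d = 3 (1/μ ∈ L¹(T³)). [cite: Balaban1983Higgs3, (3.24) p.439] -/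
private theorem integrableOn_inv_two_mul_lapSymbol_three :
    IntegrableOn (fun p : Fin 3 → ℝ => (2 * lapSymbol 3 1 p)⁻¹) (bzBox 3 1) volume := by
  have hg : Integrable (fun θ : UnitAddTorus (Fin 3) => (2 * latticeDispersion θ)⁻¹) volume := by
    have h := (integrable_inv_latticeDispersion (ι := Fin 3) (by simp)).const_mul (2⁻¹ : ℝ)
    refine h.congr (ae_of_all _ fun θ => ?_)
    simp only [mul_inv]
  refine integrableOn_bzBox_of_torus one_pos ((continuous_const.mul (continuous_lapSymbol 3 1)).measurable.inv) hg
    fun x => le_of_eq ?_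
  rw [lapSymbol_smul one_pos, latticeDispersion_coe, inv_one, one_pow, one_mul]

/-- kernel: (Δ¹)^{−3/4} is integrable on the box |p_μ| ≤ π in d = 2. [cite: Balaban1983Higgs3, (3.24) p.439] -/
private theorem integrableOn_rpow_lapSymbol_two :
    IntegrableOn (fun p : Fin 2 → ℝ => (lapSymbol 2 1 p) ^ (-(3 / 4 : ℝ))) (bzBox 2 1) volume := by
  refine integrableOn_bzBox_of_torus one_pos ((continuous_lapSymbol 2 1).measurable.pow_const _)
    integrable_rpow_latticeDispersion_two fun x => le_of_eq ?_
  rw [lapSymbol_smul one_pos, latticeDispersion_coe, inv_one, one_pow, one_mul]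

/-- **The pointwise limit** of the integrand of (3.24)'s right side as ξ → 0 exists at EVERY p′ (where Δ¹(p′) = 0 the numerator
cos p′_μ − 1 vanishes too). [cite: Balaban1983Higgs3, (3.24) p.439] -/
private theorem tendsto_integrand324 (μ : Fin d) (p : Fin d → ℝ) :
    Tendsto (fun ξ : ℝ => (Real.cos (p μ) - 1) / (lapSymbol d 1 p + ξ ^ 2) ^ 2) (𝓝 0)
      (𝓝 ((Real.cos (p μ) - 1) / (lapSymbol d 1 p + (0 : ℝ) ^ 2) ^ 2)) := by
  by_cases hnum : Real.cos (p μ) - 1 = 0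
  · simp only [hnum, zero_div]
    exact tendsto_const_nhds
  · have hΛ : 0 < lapSymbol d 1 p := by
      rcases (lapSymbol_nonneg d 1 p).eq_or_lt with h0 | h
      · exact absurd (by linarith [two_sub_two_cos_le_lapSymbol p μ, Real.cos_le_one (p μ)]) hnum
      · exact h
    have hc : Continuous fun ξ : ℝ => (Real.cos (p μ) - 1) / (lapSymbol d 1 p + ξ ^ 2) ^ 2 :=
      continuous_const.div ((continuous_const.add (continuous_pow 2)).pow 2) fun ξ => by positivity
    exact hc.tendsto 0

/-- **(3.24)'s limit sentence, d = 3** p. 439 [PDF 29] of [Balaban1983Higgs3], verbatim *"and the expression on the right side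
has a finite limit as ξ → 0"* — PROVED by dominated convergence: the right member of (3.24),
(2π)^{−3}[∫_{|p′|≤π} dp′ (cos p′_μ − 1)/(Δ¹(p′)+ξ²)²]·ξ^{3−3}, tends to (2π)^{−3}∫_{|p′|≤π}(cos p′_μ − 1)/Δ¹(p′)² dp′ (finite:
the integrand is dominated by 1/(2Δ¹) ∈ L¹). [cite: Balaban1983Higgs3, (3.24) p.439] -/
theorem eq324_rhs_tendsto_three (μ : Fin 3) :
    Tendsto (fun ξ : ℝ => (2 * Real.pi)⁻¹ ^ 3 *
        (∫ p' in bzBox 3 1, (Real.cos (p' μ) - 1) / (lapSymbol 3 1 p' + ξ ^ 2) ^ 2) * ξ ^ ((3 : ℤ) - (3 : ℕ)))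
      (𝓝 0) (𝓝 ((2 * Real.pi)⁻¹ ^ 3 * ∫ p' in bzBox 3 1, (Real.cos (p' μ) - 1) / (lapSymbol 3 1 p') ^ 2)) := by
  have hz : ∀ ξ : ℝ, ξ ^ ((3 : ℤ) - (3 : ℕ)) = 1 := fun ξ => by norm_num
  simp_rw [hz, mul_one]
  refine Tendsto.const_mul _ ?_
  have hDCT := tendsto_integral_filter_of_dominated_convergence
    (μ := volume.restrict (bzBox 3 1)) (l := 𝓝 (0 : ℝ))
    (F := fun (ξ : ℝ) (p : Fin 3 → ℝ) => (Real.cos (p μ) - 1) / (lapSymbol 3 1 p + ξ ^ 2) ^ 2)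
    (f := fun p => (Real.cos (p μ) - 1) / (lapSymbol 3 1 p + (0 : ℝ) ^ 2) ^ 2)
    (fun p => (2 * lapSymbol 3 1 p)⁻¹)
    (Filter.Eventually.of_forall fun ξ => (measurable_integrand324 μ ξ).aestronglyMeasurable)
    (Filter.Eventually.of_forall fun ξ => ae_of_all _ fun p => by
      rw [Real.norm_eq_abs]; exact abs_integrand324_le μ ξ p)
    integrableOn_inv_two_mul_lapSymbol_three
    (ae_of_all _ fun p => tendsto_integrand324 μ p)
  simpa using hDCT

/-- **Pointwise bound with a gain in ξ** (for d = 2): for ξ ≠ 0,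
|(cos p′_μ − 1)/(Δ¹(p′)+ξ²)²| ≤ ½(ξ²)^{−1/4}Δ¹(p′)^{−3/4} (from 1/(Δ+ξ²) ≤ Δ^{−3/4}(ξ²)^{−1/4}, the weighted AM–GM
inequality Δ^{3/4}(ξ²)^{1/4} ≤ ¾Δ + ¼ξ²). [cite: Balaban1983Higgs3, (3.24) p.439] -/
private theorem abs_integrand324_le_rpow (μ : Fin d) {ξ : ℝ} (hξ : ξ ≠ 0) (p : Fin d → ℝ) :
    |(Real.cos (p μ) - 1) / (lapSymbol d 1 p + ξ ^ 2) ^ 2| ≤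
      1 / 2 * (ξ ^ 2) ^ (-(1 / 4 : ℝ)) * (lapSymbol d 1 p) ^ (-(3 / 4 : ℝ)) := by
  have hΛ := lapSymbol_nonneg d 1 p
  have hc := two_sub_two_cos_le_lapSymbol p μ
  have hξ2 : 0 < ξ ^ 2 := by positivity
  rcases hΛ.eq_or_lt with h0 | hpos
  · have hcos : Real.cos (p μ) - 1 = 0 := by linarith [Real.cos_le_one (p μ)]
    rw [hcos, zero_div, abs_zero]
    exact mul_nonneg (mul_nonneg (by norm_num) (Real.rpow_nonneg hξ2.le _)) (Real.rpow_nonneg hΛ _)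
  · -- Young: Δ^{3/4}(ξ²)^{1/4} ≤ Δ + ξ²
    have hy : (lapSymbol d 1 p) ^ (3 / 4 : ℝ) * (ξ ^ 2) ^ (1 / 4 : ℝ) ≤ lapSymbol d 1 p + ξ ^ 2 := by
      have h := Real.geom_mean_le_arith_mean2_weighted (w₁ := 3 / 4) (w₂ := 1 / 4) (p₁ := lapSymbol d 1 p)
        (p₂ := ξ ^ 2) (by norm_num) (by norm_num) hΛ hξ2.le (by norm_num)
      linarith
    have hA : 0 < (lapSymbol d 1 p) ^ (3 / 4 : ℝ) := Real.rpow_pos_of_pos hpos _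
    have hB : 0 < (ξ ^ 2) ^ (1 / 4 : ℝ) := Real.rpow_pos_of_pos hξ2 _
    have hden : 0 < lapSymbol d 1 p + ξ ^ 2 := add_pos_of_pos_of_nonneg hpos hξ2.le
    rw [abs_div, abs_of_nonpos (by linarith [Real.cos_le_one (p μ)]), abs_of_nonneg (sq_nonneg _), neg_sub]
    calc (1 - Real.cos (p μ)) / (lapSymbol d 1 p + ξ ^ 2) ^ 2
        ≤ (lapSymbol d 1 p / 2) / (lapSymbol d 1 p + ξ ^ 2) ^ 2 :=
          div_le_div_of_nonneg_right (by linarith) (sq_nonneg _)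
      _ ≤ (lapSymbol d 1 p / 2) / ((lapSymbol d 1 p + ξ ^ 2) * ((lapSymbol d 1 p) ^ (3 / 4 : ℝ) * (ξ ^ 2) ^ (1 / 4 : ℝ))) :=
          div_le_div_of_nonneg_left (by linarith) (mul_pos hden (mul_pos hA hB))
            (by nlinarith [mul_le_mul_of_nonneg_left hy hden.le])
      _ ≤ 1 / 2 / ((lapSymbol d 1 p) ^ (3 / 4 : ℝ) * (ξ ^ 2) ^ (1 / 4 : ℝ)) := by
          rw [div_le_div_iff₀ (mul_pos hden (mul_pos hA hB)) (mul_pos hA hB)]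
          have : lapSymbol d 1 p ≤ lapSymbol d 1 p + ξ ^ 2 := le_add_of_nonneg_right hξ2.le
          nlinarith [mul_pos hA hB]
      _ = 1 / 2 * (ξ ^ 2) ^ (-(1 / 4 : ℝ)) * (lapSymbol d 1 p) ^ (-(3 / 4 : ℝ)) := by
          rw [Real.rpow_neg hξ2.le, Real.rpow_neg hΛ]
          field_simp

/-- kernel: (ξ²)^{−1/4}·|ξ| = |ξ|^{1/2} for ξ ≠ 0. [folklore] -/
private theorem rpow_sq_mul_abs {ξ : ℝ} (hξ : ξ ≠ 0) : (ξ ^ 2) ^ (-(1 / 4 : ℝ)) * |ξ| = |ξ| ^ (1 / 2 : ℝ) := by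
  have ha : 0 < |ξ| := abs_pos.2 hξ
  rw [← sq_abs, show (|ξ| ^ 2 : ℝ) = |ξ| ^ (2 : ℝ) by norm_cast, ← Real.rpow_mul ha.le]
  conv_lhs => rw [show (|ξ| : ℝ) = |ξ| ^ (1 : ℝ) by rw [Real.rpow_one], ← Real.rpow_mul ha.le, ← Real.rpow_add ha]
  norm_num

/-- **(3.24)'s limit sentence, d = 2** p. 439 [PDF 29] of [Balaban1983Higgs3] — PROVED: the right member of (3.24),
(2π)^{−2}[∫_{|p′|≤π} dp′ (cos p′_μ − 1)/(Δ¹(p′)+ξ²)²]·ξ^{3−2}, tends to 0 as ξ → 0 (it is O(|ξ|^{1/2}): the integral is at most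
½(ξ²)^{−1/4}∫_{|p′|≤π}Δ¹(p′)^{−3/4} dp′, and (Δ¹)^{−3/4} ∈ L¹ in two dimensions). [cite: Balaban1983Higgs3, (3.24) p.439] -/
theorem eq324_rhs_tendsto_two (μ : Fin 2) :
    Tendsto (fun ξ : ℝ => (2 * Real.pi)⁻¹ ^ 2 *
        (∫ p' in bzBox 2 1, (Real.cos (p' μ) - 1) / (lapSymbol 2 1 p' + ξ ^ 2) ^ 2) * ξ ^ ((3 : ℤ) - (2 : ℕ)))
      (𝓝 0) (𝓝 0) := by
  set K : ℝ := ∫ p' in bzBox 2 1, (lapSymbol 2 1 p') ^ (-(3 / 4 : ℝ)) with hK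
  have hK0 : 0 ≤ K := integral_nonneg fun p => Real.rpow_nonneg (lapSymbol_nonneg 2 1 p) _
  have hz : ∀ ξ : ℝ, ξ ^ ((3 : ℤ) - (2 : ℕ)) = ξ := fun ξ => by norm_num
  simp_rw [hz]
  refine squeeze_zero_norm (a := fun ξ => (2 * Real.pi)⁻¹ ^ 2 * (1 / 2 * K) * |ξ| ^ (1 / 2 : ℝ)) (fun ξ => ?_) ?_
  · rcases eq_or_ne ξ 0 with rfl | hξ
    · simp [Real.zero_rpow]
    · have hI : ‖∫ p' in bzBox 2 1, (Real.cos (p' μ) - 1) / (lapSymbol 2 1 p' + ξ ^ 2) ^ 2‖ ≤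
          1 / 2 * (ξ ^ 2) ^ (-(1 / 4 : ℝ)) * K := by
        have hg := integrableOn_rpow_lapSymbol_two.const_mul (1 / 2 * (ξ ^ 2) ^ (-(1 / 4 : ℝ)))
        have h := norm_integral_le_of_norm_le hg (ae_of_all _ fun p => by
          rw [Real.norm_eq_abs]; exact abs_integrand324_le_rpow μ hξ p)
        rwa [integral_const_mul] at h
      rw [norm_mul, norm_mul, Real.norm_eq_abs, Real.norm_eq_abs ξ, abs_of_nonneg (by positivity)]
      calc (2 * Real.pi)⁻¹ ^ 2 * ‖∫ p' in bzBox 2 1, (Real.cos (p' μ) - 1) / (lapSymbol 2 1 p' + ξ ^ 2) ^ 2‖ * |ξ|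
          ≤ (2 * Real.pi)⁻¹ ^ 2 * (1 / 2 * (ξ ^ 2) ^ (-(1 / 4 : ℝ)) * K) * |ξ| := by gcongr
        _ = (2 * Real.pi)⁻¹ ^ 2 * (1 / 2 * K) * ((ξ ^ 2) ^ (-(1 / 4 : ℝ)) * |ξ|) := by ring
        _ = (2 * Real.pi)⁻¹ ^ 2 * (1 / 2 * K) * |ξ| ^ (1 / 2 : ℝ) := by rw [rpow_sq_mul_abs hξ]
  · have hc : Continuous fun ξ : ℝ => (2 * Real.pi)⁻¹ ^ 2 * (1 / 2 * K) * |ξ| ^ (1 / 2 : ℝ) :=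
      continuous_const.mul (continuous_abs.rpow_const fun _ => Or.inr (by norm_num))
    simpa [Real.zero_rpow] using hc.tendsto 0

/-- **(3.24)** p. 439 [PDF 29] of [Balaban1983Higgs3] (row B3.Eq3.21-3.24), the SENTENCE after the display, verbatim: *"and the
expression on the right side has a finite limit as ξ → 0. Hence the last graph in (3.22) defines a vertex with some convergent
function."* — its first part PROVED in the paper's dimensions d = 2, 3 for the right member of (3.24) exactly as typed in
`B3Sect3VectorSelfEnergy.Eq324` (the vertex of (3.22) is not typed). [cite: Balaban1983Higgs3, (3.24) p.439] -/
theorem eq324_rhs_finite_limit (hd : d = 2 ∨ d = 3) (μ : Fin d) :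
    ∃ l : ℝ, Tendsto (fun ξ : ℝ => (2 * Real.pi)⁻¹ ^ d *
        (∫ p' in bzBox d 1, (Real.cos (p' μ) - 1) / (lapSymbol d 1 p' + ξ ^ 2) ^ 2) * ξ ^ ((3 : ℤ) - d))
      (𝓝[>] 0) (𝓝 l) := by
  rcases hd with rfl | rfl
  · exact ⟨0, (eq324_rhs_tendsto_two μ).mono_left nhdsWithin_le_nhds⟩
  · exact ⟨_, (eq324_rhs_tendsto_three μ).mono_left nhdsWithin_le_nhds⟩

end Limit324

end

end Literature.MathematicalPhysics.QuantumFieldTheory.Balaban1983to89.B3Eq324Parseval
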